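import Summits.BirchSwinnertonDyer.Rank1Residual.X11b.RouteR1HalvesAllFrames
import HarnessLib

/-!
# X11b, route R1 at `p ≥ 5` — the gen-21 record REPAIRED over the corrected ∀-frame half H3∀′
# (`R1.IMCEqAllFramesOnTree`, binder `Ω_K ≠ 0`): `BSD(E,p)` on semistable pairs of
# `R1Population ∩ {r_an = 1}` from 8 PUBLISHED + 5 CITED facts + ONE non-vacuous open input

HONEST FRAMING (cell `b2b-bsdres`, run/shared/lean/b2b/bsd-rank1-residual/, verbatim in every
file): the goal of the cell is to DELETE the COMBINATION-SHAPED residual classes of the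
Birch–Swinnerton-Dyer formula for ALL analytic-rank `≤ 1` elliptic curves over `ℚ` — "full BSD
formula for every rank `≤ 1` curve in class `C`" assembled STRICTLY from published theorems — so
that the rank-`≤ 1` remainder becomes exactly the CONSTRUCTION-SHAPED classes, which are TYPED
(missing-input `Prop`s), NOT attempted. This is not "finishing BSD". Sub-cell
`b2b-bsdres-multr1-p1` (X11b, route R1, gen 26); a RESEARCH ROUTE; no claim beyond the stated
class; X11b stays CONSTRUCTION-SHAPED; nothing here changes a label; THEOREMS ONLY, all CONDITIONAL
on the OPEN shape H3∀′; no definition, no named fact, no `sorry`.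

## What this file does

Gen 21's record `R1.bsdp_of_imcEq_final` consumed `R1.IMCEqOnTree W p`, a ∀-frame shape WITHOUT the
binder `Ω_K ≠ 0`, refutable on the population (`RouteR1HalvesDegenerateFrame.lean`), hence vacuously
conditional. The corrected shape H3∀′ = `R1.IMCEqAllFramesOnTree W p` (`RouteR1HalvesAllFrames.lean`:
the gen-21 body verbatim plus `Ω_K ≠ 0`) is, on semistable pairs and given A206, EQUIVALENT to the
∃-core shape of record `R1.IMCEqCoreFrameOnTree` (`R1.imcEqAllFramesOnTree_iff_imcEqCoreFrame`).
Here the gen-21 statements are re-run over H3∀′: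

* `R1.openInputOnTreeAt_of_thm32_of_imcEqAllFrames` — `h32`, `hmod`, `hGZK`, the five CITED
  control facts, one embedding datum `ι`, a SEMISTABLE pair and H3∀′ ⟹ `R1OpenInputOnTreeAt W p`;
* **`R1.bsdp_of_thm32_of_imcEqAllFrames_record`** — `BSD(E,p)` on SEMISTABLE pairs of
  `R1Population ∩ {r_an = 1}` from EIGHT PUBLISHED facts (incl. `h32`), FIVE CITED facts and H3∀′
  (same fact list as gen 21; through gen 25's `R1.bsdp_of_thm32_of_imcEqCoreFrame_record`);
  `R1.openInput_and_bsdp_of_thm32_of_imcEqAllFrames_record` — both sides of gen 19's tightness.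

CONDITIONAL on H3∀′ (open: erratum Thm. 1.1 for Castella's `L_p(f)`, ⇐ [FW21, Thm. 4.41],
PREPRINT); deletes nothing; X11b stays CONSTRUCTION-SHAPED; no label change; wording of record
unchanged.

References: [Castella2018] Thms. 2.3, 3.1, 3.2, §5 (arXiv:1704.06608 pp. 5, 9, 12);
[Castella2018Erratum] Thm. 1.1, Thm. A′ (p. 1); [FouquetWan2021] Thm. 4.41.
-/

noncomputable section

open scoped Classical

open WeierstrassCurve NumberField IsDedekindDomain Field PowerSeries
open Literature.NumberTheory.EllipticCurves Literature.NumberTheory.EllipticCurves.GreenbergSelmer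
open Literature.NumberTheory.EllipticCurves.ModularForms
open Literature.NumberTheory.EllipticCurves.Rank1Residual
open Literature.NumberTheory.EllipticCurves.Rank1Residual.Typed
open Literature.NumberTheory.EllipticCurves.Castella2018
open Literature.NumberTheory.GaloisRepresentations
open Literature.NumberTheory.GaloisCohomology
open Summit.BirchSwinnertonDyer.Rank1Residual.X11b.AcSelmer
open Summit.BirchSwinnertonDyer.Rank1Residual.X11b.Halves

namespace Summit.BirchSwinnertonDyer.Rank1Residual.X11b

/-! ### The gen-21 record, repaired (semistable pairs) -/

section Record

variable {W : WeierstrassCurve ℚ} [W.IsElliptic] [W.IsGloballyMinimal] {p : ℕ} [Fact p.Prime]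

/-- **Route R1's open input FROM PRINT ∧ H3∀′, on a semistable pair at `p ≥ 5`** — gen 21's
`R1.openInputOnTreeAt_of_imcEq` with its refutable hypothesis `R1.IMCEqOnTree W p` replaced by the
corrected H3∀′: given `h32`, `hmod`, `hGZK`, the five CITED control facts, ONE embedding datum `ι` and
H3∀′, `R1OpenInputOnTreeAt W p` (through H3∃⁻ ⟹ H3∃ ⟹ gen 22's `R1.openInputOnTreeAt_of_imcEqFrame`).
CONDITIONAL on H3∀′ (open). [cite: Castella2018, Thms. 2.3, 3.1, 3.2 and §5 (arXiv:1704.06608 pp. 5, 9, 12)]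
[cite: Castella2018Erratum, Thm. 1.1 (p. 1)] -/
theorem R1.openInputOnTreeAt_of_thm32_of_imcEqAllFrames
    (h32 : thm32_exists_isBDPLFunction_valueAtOne) (hmod : exists_isNewformOf)
    (hGZK : rank_eq_analyticRank_of_analyticRank_le_one)
    (hPT : ∀ (K : Type) [Field K] [NumberField K], poitouTate_selmerStructure_duality K)
    (hPT2 : ∀ (K : Type) [Field K] [NumberField K], poitouTate_sha_tateDual K)
    (hEP : ∀ (K : Type) [Field K] [NumberField K] (v : HeightOneSpectrum (𝓞 K)),
      localEulerPoincareCharacteristic (v.adicCompletion K))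
    (hcd : fieldCdLE_two_of_numberField)
    (hBr : ∀ (K : Type) [Field K] [NumberField K] (p : ℕ) [Fact p.Prime],
      ZpExtension.decomp_not_le_kerSubgroup_of_isAnticyclotomic K p)
    (ι : PadicAlgCl p ≃+* ℂ) (hss : Semistable W) (h3 : R1.IMCEqAllFramesOnTree W p) :
    R1OpenInputOnTreeAt W p :=
  R1.openInputOnTreeAt_of_imcEqFrame hmod hGZK hPT hPT2 hEP hcd hBr ι
    (R1.imcEqFrameOnTree_of_thm32_of_imcEqCoreFrame h32 hss
      (R1.imcEqCoreFrameOnTree_of_imcEqAllFrames_of_thm32 h32 hss h3))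

/-- **Route R1 — THE GEN-21 RECORD REPAIRED (gen 26), semistable pairs, `p ≥ 5`: 8 PUBLISHED + 5 CITED +
ONE OPEN ∀-frame input WITH `Ω_K ≠ 0`.** For every SEMISTABLE globally minimal elliptic `W/ℚ` and
prime `p` on `R1Population` with `ord_{s=1} L(E,s) = 1`: `BSD(E,p)`, from the EIGHT PUBLISHED named
facts `hGZ` (Gross–Zagier 1986 I.7.3), `hGZK`, `hSk` (Skinner 2016 Thm. C), `hmod`, `hCST`
(Cai–Shu–Tian 2014 Thm. 1.1), `hFH` (Friedberg–Hoffstein 1995 Thm. B), `hMaz` (Mazur 1978 Cor. 4.1),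
`h32` (Cas18 Thms. 3.1–3.2), the FIVE CITED cohomological facts `hPT hPT2 hEP hcd hBr`, and the ONE
OPEN input `h3 : R1.IMCEqAllFramesOnTree W p` — erratum Thm. 1.1's equality
`Ch_Λ(X_ac^∅(E[p^∞]))·R₀⟦T⟧ = (L)` at every GENUINE frame (`Ω_K ≠ 0`), equivalently (§4, given A206) at
SOME frame per datum (`R1.IMCEqCoreFrameOnTree`). Same fact list as gen 21's `R1.bsdp_of_imcEq_final`,
whose hypothesis `R1.IMCEqOnTree W p` was refutable (`RouteR1HalvesDegenerateFrame.lean`); this one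
is not refutable that way and agrees with the records of record. HONEST CONTENT of the open input:
erratum Thm. 1.1 for Castella's `L_p(f)` (⇐ [FW21, Thm. 4.41], PREPRINT). CONDITIONAL; deletes
nothing; X11b stays CONSTRUCTION-SHAPED; no label change.
[cite: Castella2018, §5 (arXiv:1704.06608 p. 12)] [cite: Castella2018Erratum, Thm. 1.1, Thm. A′ (p. 1)] -/
theorem R1.bsdp_of_thm32_of_imcEqAllFrames_record
    (hGZ : GrossZagier1986_thm_I_7_3) (hGZK : rank_eq_analyticRank_of_analyticRank_le_one)
    (hSk : Skinner2016.thmC_padicValRat_bsd_rank_zero) (hmod : exists_isNewformOf)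
    (hCST : CaiShuTian2014.thm11_trivialChar)
    (hFH : friedbergHoffstein_exists_twist_ne_zero_ramifiedAt)
    (hMaz : mazur_not_dvd_maninConstant_of_odd) (h32 : thm32_exists_isBDPLFunction_valueAtOne)
    (hPT : ∀ (K : Type) [Field K] [NumberField K], poitouTate_selmerStructure_duality K)
    (hPT2 : ∀ (K : Type) [Field K] [NumberField K], poitouTate_sha_tateDual K)
    (hEP : ∀ (K : Type) [Field K] [NumberField K] (v : HeightOneSpectrum (𝓞 K)),
      localEulerPoincareCharacteristic (v.adicCompletion K))
    (hcd : fieldCdLE_two_of_numberField)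
    (hBr : ∀ (K : Type) [Field K] [NumberField K] (p : ℕ) [Fact p.Prime],
      ZpExtension.decomp_not_le_kerSubgroup_of_isAnticyclotomic K p)
    (hss : Semistable W) (h3 : R1.IMCEqAllFramesOnTree W p) (hW : R1Population W p)
    (hr : W.analyticRank = 1) : BSDp W p :=
  R1.bsdp_of_thm32_of_imcEqCoreFrame_record hGZ hGZK hSk hmod hCST hFH hMaz h32 hPT hPT2 hEP hcd hBr
    hss (R1.imcEqCoreFrameOnTree_of_imcEqAllFrames_of_thm32 h32 hss h3) hW hr

/-- **Both sides of gen 19's tightness under `h32 ∧ H3∀′` on SEMISTABLE pairs**: the open input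
`R1OpenInputOnTreeAt W p` AND `BSDp W p`. CONDITIONAL on H3∀′ (open).
[cite: Castella2018, §5 (arXiv:1704.06608 p. 12)] [cite: Castella2018Erratum, Thm. 1.1 (p. 1)] -/
theorem R1.openInput_and_bsdp_of_thm32_of_imcEqAllFrames_record
    (hGZ : GrossZagier1986_thm_I_7_3) (hGZK : rank_eq_analyticRank_of_analyticRank_le_one)
    (hSk : Skinner2016.thmC_padicValRat_bsd_rank_zero) (hmod : exists_isNewformOf)
    (hCST : CaiShuTian2014.thm11_trivialChar)
    (hFH : friedbergHoffstein_exists_twist_ne_zero_ramifiedAt)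
    (hMaz : mazur_not_dvd_maninConstant_of_odd) (h32 : thm32_exists_isBDPLFunction_valueAtOne)
    (hPT : ∀ (K : Type) [Field K] [NumberField K], poitouTate_selmerStructure_duality K)
    (hPT2 : ∀ (K : Type) [Field K] [NumberField K], poitouTate_sha_tateDual K)
    (hEP : ∀ (K : Type) [Field K] [NumberField K] (v : HeightOneSpectrum (𝓞 K)),
      localEulerPoincareCharacteristic (v.adicCompletion K))
    (hcd : fieldCdLE_two_of_numberField)
    (hBr : ∀ (K : Type) [Field K] [NumberField K] (p : ℕ) [Fact p.Prime],
      ZpExtension.decomp_not_le_kerSubgroup_of_isAnticyclotomic K p)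
    (hss : Semistable W) (h3 : R1.IMCEqAllFramesOnTree W p) (hW : R1Population W p)
    (hr : W.analyticRank = 1) : R1OpenInputOnTreeAt W p ∧ BSDp W p :=
  R1.openInput_and_bsdp_of_thm32_of_imcEqCoreFrame_record hGZ hGZK hSk hmod hCST hFH hMaz h32 hPT
    hPT2 hEP hcd hBr hss (R1.imcEqCoreFrameOnTree_of_imcEqAllFrames_of_thm32 h32 hss h3) hW hr

end Record

end Summit.BirchSwinnertonDyer.Rank1Residual.X11b

end
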